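import Literature.Barriers.RiemannHypothesis.MollifierLimitationsProofs
import Literature.NumberTheory.LFunctions.SelbergMollifier
import HarnessLib

/-!
# Radziwiłł 2012, Lemma 5 from Selberg's lemma (the measure of `E`)

Sibling of `Literature/Barriers/RiemannHypothesis/MollifierLimitationsProofs.lean`, which vendors
**Lemma 5** of M. Radziwiłł, *Limitations to mollifying `ζ(s)`* (arXiv:1207.6583), §4, as the
named fact `Literature.Barriers.RiemannHypothesis.Radziwill2012_lemma5` (a `2πA/log T`-well-spaced
set of `≫ T log T` zeros of `ζ` on the critical line with ordinates in `[T, 2T]`), one of the three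
inputs of the proved deduction `Radziwill2012_thm1_of_inputs` of Theorem 1.

The printed proof of Lemma 5 (§4, p. 8) has two steps:

1. *Selberg's lemma* (the analytic input, from Selberg's method as in Titchmarsh §10.22, where it
   is the inequality `m(E) > A₃ T` inside the proof of Theorem 10.22 `N₀(T) > A T log T`): "there is
   an `h = 2πA/log T`, with `A > 0` constant, for which the set
   `E = {T ≤ t ≤ 2T : γ ∈ (t; t + h) for some ρ = ½ + iγ}` has `meas{E} ≥ c · T` with `c > 0`
   constant." This is vendored here as the named fact `Radziwill2012_selbergLemma`.
2. *Interval combinatorics* (every third interval of length `h` meeting `E` yields a zero, and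
   zeros from intervals three apart are `h`-separated). This step is **proved** here:
   `Radziwill2012_lemma5_of_selbergLemma : Radziwill2012_selbergLemma → Radziwill2012_lemma5`,
   with the constants `A` (the same `A`) and `c₀ = c/(12πA)`.

So after this file the trust base of `Radziwill2012_lemma5` is exactly Selberg's lemma.

## The combinatorial step, as proved

Fix `T` large, `h = 2πA/log T`, and let `E' = E ∩ [T, 2T − h]` (so that the zero attached to
`t ∈ E'` has ordinate `< 2T`); `meas E' ≥ cT − h`. Cover `[T, 2T]` by the intervals
`J_n = [T + nh, T + (n+1)h)`, `0 ≤ n ≤ ⌊T/h⌋`, and let `G` be the set of `n` with `J_n ∩ E' ≠ ∅`.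
Then `E' ⊆ ⋃_{n ∈ G} J_n`, so `(card G) · h ≥ cT − h`. For `n ∈ G` pick `t_n ∈ J_n ∩ E'` and a
critical ordinate `γ_n ∈ (t_n, t_n + h)`, so `T + nh < γ_n < T + (n+2)h`, `T < γ_n < 2T`. One residue
class `r mod 3` has `card G_r ≥ card G / 3`; for `n < n'` in `G_r`, `n' ≥ n + 3`, hence
`γ_{n'} − γ_n > h`. Thus `S = {γ_n : n ∈ G_r}` is `h`-separated, consists of critical ordinates in
`[T, 2T]`, and `card S ≥ (cT/h − 1)/3 = cT log T/(6πA) − 1/3 ≥ (c/(12πA)) T log T` once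
`T log T ≥ 4πA/c`. (Radziwiłł takes every third of the `≥ cT/(2h)` double intervals; the count
above is the same argument with the bookkeeping made explicit.)

## References

* [Radziwill2012] M. Radziwiłł, *Limitations to mollifying ζ(s)*, arXiv:1207.6583 (2012), §4,
  Lemma 5 and its proof (p. 8 of the arXiv version).
* [Titchmarsh1986] E. C. Titchmarsh, *The Theory of the Riemann Zeta-Function*, 2nd ed. revised by
  D. R. Heath-Brown (1986), §10.22, Theorem 10.22 and its proof (`m(E) > A₃T`, p. 279).
* [Selberg1942] A. Selberg, *On the zeros of Riemann's zeta-function*, Skr. Norske Vid. Akad. Oslo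
  I. 10 (1942).
-/

noncomputable section

open Complex MeasureTheory Real Set

namespace Literature.Barriers.RiemannHypothesis

/-! ## Selberg's lemma, as a named fact -/

/-- **Selberg's lemma (measure form, dyadic), as used by Radziwiłł 2012, §4.** "Selberg's proof
([Titchmarsh], 10.22, p. 279) shows that there is an `h = 2πA/log T`, with `A > 0` constant, for
which the set `E = {T ≤ t ≤ 2T : γ ∈ (t; t + h) for some ρ = ½ + iγ}` has `meas{E} ≥ c · T` with
`c > 0` constant." Vendored for all large `T`, with Lebesgue (outer) measure and the zero condition
`ζ(½ + iγ) = 0`: there are absolute `A, c > 0` and `T₀` such that for `T ≥ T₀`,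
`volume {t ∈ [T, 2T] : ∃ γ ∈ (t, t + 2πA/log T), ζ(½ + iγ) = 0} ≥ cT`. In Titchmarsh's
Theorem 10.22 the interval is `(0, T)`, `h = 1/(ac log T)` and the zeros found are sign changes of
`Z(u)` (odd-order critical zeros); the dyadic form is the one printed by Radziwiłł.
[cite: Radziwill2012, §4, proof of Lemma 5] [cite: Titchmarsh1986, Thm. 10.22] -/
def Radziwill2012_selbergLemma : Prop :=
  ∃ A : ℝ, 0 < A ∧ ∃ c : ℝ, 0 < c ∧ ∃ T₀ : ℝ, ∀ T : ℝ, T₀ ≤ T →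
    ENNReal.ofReal (c * T) ≤
      volume {t : ℝ | t ∈ Icc T (2 * T) ∧
        ∃ γ ∈ Ioo t (t + 2 * π * A / Real.log T), riemannZeta (1 / 2 + γ * I) = 0}

/-! ## The combinatorial step -/

/-- Pigeonhole modulo `3` on a finite set of naturals: some residue class carries at least a third
of the elements. [folklore] -/
theorem exists_residue_three_card_le (G : Finset ℕ) :
    ∃ r : ℕ, (G.card : ℝ) ≤ 3 * ((G.filter fun n ↦ n % 3 = r).card : ℝ) := by
  by_contra hcon
  push Not at hcon
  have h0 := hcon 0
  have h1 := hcon 1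
  have h2 := hcon 2
  -- `G` is the disjoint union of the three residue classes
  have hcover : G.card ≤ (G.filter fun n ↦ n % 3 = 0).card + (G.filter fun n ↦ n % 3 = 1).card +
      (G.filter fun n ↦ n % 3 = 2).card := by
    calc G.card = (G.filter fun n ↦ n % 3 = 0).card + (G.filter fun n ↦ ¬ n % 3 = 0).card :=
          (Finset.card_filter_add_card_filter_not _).symm
      _ ≤ (G.filter fun n ↦ n % 3 = 0).card + ((G.filter fun n ↦ n % 3 = 1).card +
            (G.filter fun n ↦ n % 3 = 2).card) := by
          gcongr
          calc (G.filter fun n ↦ ¬ n % 3 = 0).card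
                ≤ ((G.filter fun n ↦ n % 3 = 1) ∪ (G.filter fun n ↦ n % 3 = 2)).card := by
                  apply Finset.card_le_card
                  intro n hn
                  simp only [Finset.mem_filter, Finset.mem_union] at hn ⊢
                  obtain ⟨hnG, hn0⟩ := hn
                  have h12 : n % 3 = 1 ∨ n % 3 = 2 := by omega
                  rcases h12 with h1 | h2
                  · exact Or.inl ⟨hnG, h1⟩
                  · exact Or.inr ⟨hnG, h2⟩
            _ ≤ _ := Finset.card_union_le _ _
      _ = _ := by ring
  have : (G.card : ℝ) ≤ (G.filter fun n ↦ n % 3 = 0).card + (G.filter fun n ↦ n % 3 = 1).card +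
      (G.filter fun n ↦ n % 3 = 2).card := by exact_mod_cast hcover
  linarith

/-- **Radziwiłł 2012, Lemma 5, from Selberg's lemma** (the combinatorial half of the printed proof,
§4): if `meas{t ∈ [T, 2T] : ζ has a critical zero with ordinate in (t, t + h)} ≥ cT` for
`h = 2πA/log T` and all large `T`, then for all large `T` there is an `h`-well-spaced set of at
least `(c/(12πA)) · T log T` ordinates `γ ∈ [T, 2T]` of zeros of `ζ` on the critical line. See the
module docstring for the count. [cite: Radziwill2012, §4, proof of Lemma 5] -/
theorem Radziwill2012_lemma5_of_selbergLemma (h : Radziwill2012_selbergLemma) :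
    Radziwill2012_lemma5 := by
  obtain ⟨A, hA, c, hc, T₀, hE⟩ := h
  refine ⟨A, hA, c / (12 * π * A), by positivity, max T₀ (max (Real.exp 1) (4 * π * A / c)),
    fun T hT ↦ ?_⟩
  have hT₀ : T₀ ≤ T := le_trans (le_max_left _ _) hT
  have hTe : Real.exp 1 ≤ T := le_trans (le_trans (le_max_left _ _) (le_max_right _ _)) hT
  have hTc : 4 * π * A / c ≤ T := le_trans (le_trans (le_max_right _ _) (le_max_right _ _)) hT
  have hT1 : 1 < T := lt_of_lt_of_le (by have := Real.add_one_lt_exp (one_ne_zero); linarith) hTe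
  have hTpos : 0 < T := by linarith
  have hlog1 : 1 ≤ Real.log T := by
    rw [← Real.log_exp 1]; exact Real.log_le_log (Real.exp_pos 1) hTe
  have hlog : 0 < Real.log T := by linarith
  -- the spacing `h = 2πA / log T`
  set h : ℝ := 2 * π * A / Real.log T with hh
  have hh0 : 0 < h := by positivity
  -- the set `E` of Selberg's lemma and its truncation `E'`
  set E : Set ℝ := {t : ℝ | t ∈ Icc T (2 * T) ∧
    ∃ γ ∈ Ioo t (t + 2 * π * A / Real.log T), riemannZeta (1 / 2 + γ * I) = 0} with hEdef
  have hET : ENNReal.ofReal (c * T) ≤ volume E := hE T hT₀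
  set E' : Set ℝ := E ∩ Iic (2 * T - h) with hE'def
  have hEE' : E ⊆ E' ∪ Ioc (2 * T - h) (2 * T) := by
    intro t ht
    by_cases hle : t ≤ 2 * T - h
    · exact Or.inl ⟨ht, hle⟩
    · exact Or.inr ⟨lt_of_not_ge hle, ht.1.2⟩
  have hvolE : volume E ≤ volume E' + ENNReal.ofReal h := by
    calc volume E ≤ volume (E' ∪ Ioc (2 * T - h) (2 * T)) := measure_mono hEE'
      _ ≤ volume E' + volume (Ioc (2 * T - h) (2 * T)) := measure_union_le _ _
      _ = volume E' + ENNReal.ofReal h := by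
          rw [Real.volume_Ioc]; congr 1; congr 1; ring
  -- the covering intervals `J n = [T + n h, T + (n+1) h)`, `n ≤ M`
  set M : ℕ := ⌊T / h⌋₊ with hM
  set J : ℕ → Set ℝ := fun n ↦ Ico (T + n * h) (T + (n + 1) * h) with hJ
  classical
  set G : Finset ℕ := (Finset.range (M + 1)).filter fun n ↦ (J n ∩ E').Nonempty with hG
  have hcover : E' ⊆ ⋃ n ∈ G, J n := by
    intro t ht
    have htT : T ≤ t := ht.1.1.1
    have ht2 : t ≤ 2 * T - h := ht.2
    set n : ℕ := ⌊(t - T) / h⌋₊ with hn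
    have hnn : 0 ≤ (t - T) / h := div_nonneg (by linarith) hh0.le
    have hn1 : (n : ℝ) ≤ (t - T) / h := Nat.floor_le hnn
    have hn2 : (t - T) / h < n + 1 := Nat.lt_floor_add_one _
    have htJ : t ∈ J n := by
      refine ⟨?_, ?_⟩
      · have : (n : ℝ) * h ≤ t - T := by rwa [le_div_iff₀ hh0] at hn1
        linarith
      · have : t - T < (n + 1) * h := by rwa [div_lt_iff₀ hh0] at hn2
        linarith
    have hnM : n ≤ M := by
      apply Nat.floor_le_floor
      exact div_le_div_of_nonneg_right (by linarith) hh0.le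
    have hnG : n ∈ G := by
      rw [hG, Finset.mem_filter, Finset.mem_range]
      exact ⟨Nat.lt_succ_of_le hnM, ⟨t, htJ, ht⟩⟩
    exact Set.mem_biUnion hnG htJ
  have hvolJ : ∀ n : ℕ, volume (J n) = ENNReal.ofReal h := by
    intro n
    simp only [hJ, Real.volume_Ico]
    congr 1; ring
  have hvolE' : volume E' ≤ (G.card : ENNReal) * ENNReal.ofReal h := by
    calc volume E' ≤ volume (⋃ n ∈ G, J n) := measure_mono hcover
      _ ≤ ∑ n ∈ G, volume (J n) := measure_biUnion_finset_le _ _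
      _ = ∑ n ∈ G, ENNReal.ofReal h := by simp_rw [hvolJ]
      _ = (G.card : ENNReal) * ENNReal.ofReal h := by
          rw [Finset.sum_const, nsmul_eq_mul]
  -- hence `c T ≤ (card G + 1) h`
  have hcard : c * T ≤ ((G.card : ℝ) + 1) * h := by
    have h1 : ENNReal.ofReal (c * T) ≤ ENNReal.ofReal (((G.card : ℝ) + 1) * h) := by
      calc ENNReal.ofReal (c * T) ≤ volume E := hET
        _ ≤ (G.card : ENNReal) * ENNReal.ofReal h + ENNReal.ofReal h := by
            calc volume E ≤ volume E' + ENNReal.ofReal h := hvolE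
              _ ≤ _ := by gcongr
        _ = ENNReal.ofReal (((G.card : ℝ) + 1) * h) := by
            rw [add_mul, one_mul, ENNReal.ofReal_add (by positivity) hh0.le,
              ENNReal.ofReal_mul (by positivity), ENNReal.ofReal_natCast]
    exact (ENNReal.ofReal_le_ofReal_iff (by positivity)).1 h1
  -- pick, for `n ∈ G`, a critical ordinate `γ n ∈ (T + n h, T + (n+2) h) ∩ (T, 2T)`
  have hpick : ∀ n : ℕ, ∃ γ : ℝ, n ∈ G →
      (T + n * h < γ ∧ γ < T + (n + 2) * h) ∧ (T < γ ∧ γ < 2 * T) ∧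
        riemannZeta (1 / 2 + γ * I) = 0 := by
    intro n
    by_cases hn : n ∈ G
    · rw [hG, Finset.mem_filter] at hn
      obtain ⟨t, htJ, htE, ht2⟩ := hn.2
      obtain ⟨⟨htT, _⟩, γ, hγ, hζ⟩ := htE
      have hγ1 : t < γ := hγ.1
      have hγ2 : γ < t + h := hγ.2
      have htJ1 : T + n * h ≤ t := htJ.1
      have htJ2 : t < T + (n + 1) * h := htJ.2
      have ht2' : t ≤ 2 * T - h := ht2
      refine ⟨γ, fun _ ↦ ⟨⟨by linarith, by nlinarith⟩, ⟨by linarith, by linarith⟩, hζ⟩⟩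
    · exact ⟨0, fun h' ↦ absurd h' hn⟩
  choose γ hγ using hpick
  -- a residue class mod 3 carrying a third of `G`
  obtain ⟨r, hr⟩ := exists_residue_three_card_le G
  set Gr : Finset ℕ := G.filter fun n ↦ n % 3 = r with hGr
  have hGrG : ∀ n ∈ Gr, n ∈ G := fun n hn ↦ (Finset.mem_filter.1 hn).1
  -- separation of the chosen ordinates along `Gr`
  have hsep : ∀ n ∈ Gr, ∀ n' ∈ Gr, n < n' → γ n + h < γ n' := by
    intro n hn n' hn' hlt
    have hmod : n % 3 = n' % 3 := by
      rw [(Finset.mem_filter.1 hn).2, (Finset.mem_filter.1 hn').2]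
    have h3 : n + 3 ≤ n' := by omega
    have h3' : (n : ℝ) + 3 ≤ n' := by exact_mod_cast h3
    have hγn := (hγ n (hGrG n hn)).1.2
    have hγn' := (hγ n' (hGrG n' hn')).1.1
    nlinarith
  have hinj : Set.InjOn γ (Gr : Set ℕ) := by
    intro n hn n' hn' heq
    by_contra hne
    rcases lt_or_gt_of_ne hne with hlt | hlt
    · have := hsep n hn n' hn' hlt; linarith
    · have := hsep n' hn' n hn hlt; linarith
  -- the set `S`
  refine ⟨Gr.image γ, ?_, ?_, ?_⟩
  · intro x hx
    obtain ⟨n, hn, rfl⟩ := Finset.mem_image.1 hx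
    have hP := hγ n (hGrG n hn)
    exact ⟨⟨hP.2.1.1.le, hP.2.1.2.le⟩, hP.2.2⟩
  · intro x hx x' hx' hne
    obtain ⟨n, hn, rfl⟩ := Finset.mem_image.1 hx
    obtain ⟨n', hn', rfl⟩ := Finset.mem_image.1 hx'
    have hnn' : n ≠ n' := fun heq ↦ hne (by rw [heq])
    rcases lt_or_gt_of_ne hnn' with hlt | hlt
    · have := hsep n hn n' hn' hlt
      rw [abs_sub_comm, abs_of_pos (by linarith)]
      linarith
    · have := hsep n' hn' n hn hlt
      rw [abs_of_pos (by linarith)]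
      linarith
  · rw [Finset.card_image_of_injOn hinj]
    -- `card Gr ≥ card G / 3 ≥ (cT/h - 1)/3 ≥ (c/(12πA)) T log T`
    have hG1 : c * T / h - 1 ≤ (G.card : ℝ) := by
      rw [div_sub_one hh0.ne', div_le_iff₀ hh0]
      linarith
    have hG2 : c * T / h = c * T * Real.log T / (2 * π * A) := by
      rw [hh]; field_simp
    have hTlog : 4 * π * A / c ≤ T * Real.log T := by
      calc 4 * π * A / c ≤ T := hTc
        _ = T * 1 := (mul_one T).symm
        _ ≤ T * Real.log T := by gcongr
    have hkey : c / (12 * π * A) * T * Real.log T ≤ (c * T / h - 1) / 3 := by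
      rw [hG2]
      have hcTlog : 4 * π * A ≤ c * (T * Real.log T) := by
        have := (div_le_iff₀ hc).1 hTlog
        linarith
      have hπA : 0 < 2 * π * A := by positivity
      rw [le_div_iff₀ (by norm_num : (0 : ℝ) < 3), le_sub_iff_add_le, le_div_iff₀ hπA]
      field_simp
      nlinarith
    linarith


/-! ## Selberg's lemma from Titchmarsh's Lemmas 10.17, 10.18 and 10.20

The sibling topic file `Literature/NumberTheory/LFunctions/SelbergMollifier.lean` formalises
Titchmarsh §10.9–10.22: Selberg's coefficients `α_ν`, `β_ν`, the mollifier `φ` and the kernel `F`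
(§10.9–10.10), the measure-theoretic skeleton of Theorem 10.22 (proved), and the three analytic
inputs of the printed proof as named facts (`Titchmarsh1986_lemma_10_17`, `Titchmarsh1986_lemma_10_18`,
`Titchmarsh1986_lemma_10_20_dyadic`). Its theorem `selberg_volume_criticalZeros_ge` concludes with
the body of `Radziwill2012_selbergLemma`; the theorem below types it as such, so that the trust base
of `Radziwill2012_selbergLemma` (and hence of `Radziwill2012_lemma5`) becomes exactly these three
lemmas of Titchmarsh, to be discharged in the sibling files `SelbergMollifier*.lean`. -/

/-- **Selberg's lemma (Radziwiłł 2012, §4) from Titchmarsh's Lemmas 10.17, 10.18, 10.20.**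
`Radziwill2012_selbergLemma` follows from the three named facts of
`Literature.NumberTheory.LFunctions.SelbergMollifier` by the proved measure-theoretic form of
Titchmarsh's Theorem 10.22 (`selberg_volume_criticalZeros_ge`).
[cite: Radziwill2012, §4, proof of Lemma 5] [cite: Titchmarsh1986, Theorem 10.22] -/
theorem Radziwill2012_selbergLemma_of_titchmarsh1986
    (h17 : Literature.NumberTheory.LFunctions.SelbergMollifier.Titchmarsh1986_lemma_10_17)
    (h18 : Literature.NumberTheory.LFunctions.SelbergMollifier.Titchmarsh1986_lemma_10_18)
    (h20 : Literature.NumberTheory.LFunctions.SelbergMollifier.Titchmarsh1986_lemma_10_20_dyadic) :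
    Radziwill2012_selbergLemma :=
  Literature.NumberTheory.LFunctions.SelbergMollifier.selberg_volume_criticalZeros_ge h17 h18 h20

end Literature.Barriers.RiemannHypothesis
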